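import Mathlib
import HarnessLib
import Literature.Analysis.FluidPDE.AxisymmetricEuler
import Summits.NavierStokesRegularity.NavierStokesRegularity.Theorems.PoloidalWindowRigidity.Negative.NonflatStubFalseWithoutMild

/-!
# Crux `PoloidalWindowRigidity` (K2, stmt-NavierStokesRegularity-19708, route `PoloidalWindowDoor`) — the rev-7 residue
# `stub_residueNoScrewNoGauge` with the Oseen-mild identity deleted is FALSE, and the source-gauge stratum excludes NO
# separated profile (self-similar slope floor)

Negative-side support (refuter seat ns-regularity-refuter1, cell ns-regularity-ideate; D-0081 §C), third file of the
series `…Negative.FalseWithoutMild` (K2 minus (M): flat parasitic drift) / `…Negative.NonflatStubFalseWithoutMild`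
(registered residue `stub_nonflatLiouville` minus (M): the separated cellular profile).

The K2 lead's skeleton `Cruxes/PoloidalWindowRigidity/Lines/slicesharp.lean` at rev 7 has ONE open stub, S2′
`stub_residueNoScrewNoGauge`: the slice-wise sharpened residue with fourteen hypotheses — (R) Type-I rate, (C) slab
continuity, (M) the unit-viscosity Oseen-mild identity, (D) divergence-free slices, (P) poloidal along `e₂`, (F) the
frozen constraint, non-constant vorticity direction on every slice, not vertically rigid, `v·e₂` flat in no horizontal
direction, no translation invariance, no axisymmetry in any frame, not scale-invariant, NO SCREW INVARIANCE about a
vertical axis, and NO SOURCE GAUGE: no `C²` stream function `ψ` of the profile (`(curl v)₀ = ∂₁ψ`, `(curl v)₁ = −∂₀ψ`)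
with decaying slope `|ψ(t,x) − ψ(t,x₀)| ≤ ε(t)‖x − x₀‖`, `ε(t)√(−t) → 0` (`t → −∞`), has a source
`∂ₜψ + (v·∇)ψ − Δψ` depending on `t` only — conclusion: not backward-singular at the apex.

This file checks, by kernel, two facts about that statement, both with the separated cellular profile
`v(t,x) = (−t)^{-1/2} V(x)`, `V = (cos x₂ cos x₀, cos x₂ cos x₁, sin x₂ (sin x₀ + sin x₁))` of `…Negative.CellField`:

* `no_decayingSlope_streamFunction_cellProfile` — **the source-gauge stratum contains no separated profile.** Every
  slice-wise `C¹` stream function `ψ` of `v` (only `∂₁ψ = (curl v)₀` is used) obeys the SLOPE FLOOR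
  `4(−t)^{-1/2} ≤ ε(t)·D(x₀)` (`streamFunction_slope_floor_cellProfile`; `D(x₀) = ‖y⁺ − x₀‖ + ‖y⁻ − x₀‖` with
  `y^± = (0, ±π/2, π/2)`, by the fundamental theorem of calculus along the segment `[y⁻, y⁺]`, on which
  `∂₁ψ = 2(−t)^{-1/2} cos σ` integrates to `4(−t)^{-1/2}`), so `ε(t)√(−t) ≥ 4/D(x₀) > 0` for every `t < 0` and the
  decaying-slope condition `ε(t)√(−t) → 0` FAILS: the no-gauge hypothesis of S2′ is satisfied VACUOUSLY by `v`.
  The same computation applies verbatim to every profile of separated form `(−t)^{-1/2} U(x)` with `curl U`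
  not identically zero on horizontal lines (informal remark): the gauge dichotomy of rev 7 (tree `…SourceGauge`)
  removes only profiles whose stream-function slope decays FASTER than the self-similar amplitude.
* `residueNoScrewNoGauge_false_without_mild` — **S2′ with (M) and the all-frames axisymmetry exclusion deleted is
  FALSE**: `v` satisfies the remaining twelve hypotheses — the two new strata of rev 7 included: it is invariant under
  no screw motion (`not_screwInvariant_cellProfile`: compare third components at `(π/2, π/2, π/2)` and on the plane
  `x₂ = 0`), and the no-gauge clause holds vacuously — and it is backward-singular at the apex
  (`isBackwardSingularPoint_cellProfile`). New kinematic checks here: vorticity direction non-constant on every slice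
  (`vorticityDirection_nonconstant_cellProfile`), no translation invariance (`not_translationInvariant_cellProfile`).
  The axisymmetry exclusion is deleted only for proof economy (the witness is `2π`-periodic in each coordinate and has
  the discrete quarter-turn symmetry about the vertical axis through `(π/2, π/2, ·)`, but no continuous symmetry —
  informal remark, not kernel-checked).

CONSEQUENCE for the K2 line (lead's census, rev 7): of S2′'s fourteen hypotheses, (M) is the load-bearing one on the
separated stratum; the screw and source-gauge exclusions added at rev 7 do not touch separated profiles at all. Note
that the separated witness has `‖∇v(t)‖ ~ (−t)^{-1/2}`, so it VIOLATES the parabolic gradient rate `C₂/(−t)` for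
`−t` large (tree `…ClassRate`, a consequence of (M)+(R)): whether (M) is needed beyond its parabolic-rate consequences
is not decided by this file.

WHAT THIS IS NOT: not a claim about Navier–Stokes regularity and not a refutation of K2 or of S2′ — kernel-checked
certificates that (M) cannot be dropped from S2′ and that the source-gauge alternative is empty on separated profiles.
-/

noncomputable section

namespace Summit.NavierStokesRegularity.NavierStokesRegularity.Theorems.PoloidalWindowRigidity.Negative

open Set Function Filter Topology
open scoped RealInnerProductSpace InnerProductSpace Laplacian
open Literature.Analysis Literature.Analysis.FluidPDE

/-! ## Three more kinematic exclusions met by the cellular profile -/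

/-- The vorticity direction of the cellular profile is constant on no slice: for every `b ≠ 0` there is a point where
`curl v(s) × b ≠ 0` — at `(π/2, 0, π/2)` the vorticity is `2(−s)^{-1/2} e₀`, at `(0, π/2, π/2)` it is
`−2(−s)^{-1/2} e₁`. [folklore] -/
theorem vorticityDirection_nonconstant_cellProfile {s : ℝ} (hs : s < 0) (b : EuclideanSpace ℝ (Fin 3))
    (hb : b ≠ 0) : ∃ y : EuclideanSpace ℝ (Fin 3), cross (curl (cellProfile s) y) b ≠ 0 := by
  by_contra hcon
  simp only [not_exists, ne_eq, not_not] at hcon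
  have hamp := (cellAmp_pos hs).ne'
  have h1 := hcon ((Real.pi / 2) • EuclideanSpace.single (0 : Fin 3) (1 : ℝ) +
    (Real.pi / 2) • EuclideanSpace.single (2 : Fin 3) (1 : ℝ))
  have h2 := hcon ((Real.pi / 2) • EuclideanSpace.single (1 : Fin 3) (1 : ℝ) +
    (Real.pi / 2) • EuclideanSpace.single (2 : Fin 3) (1 : ℝ))
  have h1a := congrArg (fun w : EuclideanSpace ℝ (Fin 3) => w 1) h1
  have h1b := congrArg (fun w : EuclideanSpace ℝ (Fin 3) => w 2) h1
  have h2b := congrArg (fun w : EuclideanSpace ℝ (Fin 3) => w 2) h2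
  simp [cross, cross_apply, curl_cellProfile_apply_zero, curl_cellProfile_apply_one,
    curl_cellProfile_apply_two, hamp] at h1a h1b h2b
  apply hb
  ext i
  fin_cases i
  · simpa using h2b
  · simpa using h1b
  · simpa using h1a

/-- The cellular profile is invariant under no spatial translation: for `e ≠ 0` some translate of the origin along `e`
changes the value (`V(0) = (1,1,0)`; a quarter period along a nonzero coordinate of `e` kills a cosine). [folklore] -/
theorem not_translationInvariant_cellProfile {s : ℝ} (hs : s < 0) (e : EuclideanSpace ℝ (Fin 3)) (he : e ≠ 0) :
    ∃ (y : EuclideanSpace ℝ (Fin 3)) (l : ℝ), cellProfile s (y + l • e) ≠ cellProfile s y := by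
  by_contra hcon
  push Not at hcon
  have hamp := (cellAmp_pos hs).ne'
  have key : ∀ l : ℝ, cellField (l • e) = cellField 0 := by
    intro l
    have h := hcon 0 l
    rw [zero_add] at h
    exact smul_right_injective _ hamp h
  by_cases h2 : e 2 = 0
  · by_cases h0 : e 0 = 0
    · have h1 : e 1 ≠ 0 := by
        intro h1
        apply he
        ext i
        fin_cases i
        · exact h0
        · exact h1
        · exact h2
      have h := congrArg (fun w : EuclideanSpace ℝ (Fin 3) => w 1) (key (Real.pi / 2 / e 1))
      simp [cellField_apply_one, h2, div_mul_cancel₀ _ h1] at h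
    · have h := congrArg (fun w : EuclideanSpace ℝ (Fin 3) => w 0) (key (Real.pi / 2 / e 0))
      simp [cellField_apply_zero, h2, div_mul_cancel₀ _ h0] at h
  · have h := congrArg (fun w : EuclideanSpace ℝ (Fin 3) => w 0) (key (Real.pi / 2 / e 2))
    simp [cellField_apply_zero, div_mul_cancel₀ _ h2] at h

/-- The cellular profile is invariant under no screw motion about a vertical axis: for every angle `θ` and centre `c`,
the screw image with vertical shift `π/2` of a suitable point of the plane `x₂ = 0` (third component of `v` zero there,
and `R_θ` fixes third components) lands at `(π/2, π/2, π/2)`, where `v₂(−1, ·) = 2`. [folklore] -/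
theorem not_screwInvariant_cellProfile (θ : ℝ) (c : EuclideanSpace ℝ (Fin 3)) :
    ∃ y : EuclideanSpace ℝ (Fin 3),
      cellProfile (-1) (c + rotZ θ (y - c) + (Real.pi / 2) • EuclideanSpace.single (2 : Fin 3) (1 : ℝ)) ≠
        rotZ θ (cellProfile (-1) y) := by
  set q : EuclideanSpace ℝ (Fin 3) := (Real.pi / 2) • EuclideanSpace.single (0 : Fin 3) (1 : ℝ) +
    (Real.pi / 2) • EuclideanSpace.single (1 : Fin 3) (1 : ℝ) with hq
  refine ⟨c + rotZ (-θ) (q - c), ?_⟩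
  intro h
  have hrot : rotZ θ (c + rotZ (-θ) (q - c) - c) = q - c := by
    rw [add_sub_cancel_left, ← rotZ_add, add_neg_cancel, rotZ_zero]
  rw [hrot, add_sub_cancel] at h
  have h2 := congrArg (fun w : EuclideanSpace ℝ (Fin 3) => w 2) h
  have hy2 : (c + rotZ (-θ) (q - c)) 2 = 0 := by simp [hq]
  have hq2 : (q + (Real.pi / 2) • EuclideanSpace.single (2 : Fin 3) (1 : ℝ)) 2 = Real.pi / 2 := by simp [hq]
  have hq0 : (q + (Real.pi / 2) • EuclideanSpace.single (2 : Fin 3) (1 : ℝ)) 0 = Real.pi / 2 := by simp [hq]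
  have hq1 : (q + (Real.pi / 2) • EuclideanSpace.single (2 : Fin 3) (1 : ℝ)) 1 = Real.pi / 2 := by simp [hq]
  simp only [rotZ_apply_two, cellProfile, PiLp.smul_apply, smul_eq_mul, cellField_apply_two, hy2, hq2, hq0,
    hq1, Real.sin_pi_div_two, Real.sin_zero, zero_mul, mul_zero] at h2
  simp [cellAmp] at h2

/-! ## The self-similar slope floor: no decaying-slope stream function -/

/-- **Slope floor.** On a slice `t`, if `∂₁ψ = (curl v(t))₀` for the cellular profile `v` and `ψ` is differentiable,
then for every base point `x₀` and every `ε` with `|ψ(x) − ψ(x₀)| ≤ ε‖x − x₀‖` (all `x`) one has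
`4(−t)^{-1/2} ≤ ε (‖y⁺ − x₀‖ + ‖y⁻ − x₀‖)`, `y^± = (0, ±π/2, π/2)`: along the segment `[y⁻, y⁺]`,
`∂₁ψ = 2(−t)^{-1/2} cos σ` integrates to `ψ(y⁺) − ψ(y⁻) = 4(−t)^{-1/2}`. [folklore] -/
theorem streamFunction_slope_floor_cellProfile (t : ℝ) (ψ : EuclideanSpace ℝ (Fin 3) → ℝ) (hψ : Differentiable ℝ ψ)
    (hcurl : ∀ y, curl (cellProfile t) y 0 = fderiv ℝ ψ y (EuclideanSpace.single (1 : Fin 3) (1 : ℝ)))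
    (x₀ : EuclideanSpace ℝ (Fin 3)) (ε : ℝ) (hslope : ∀ x, |ψ x - ψ x₀| ≤ ε * ‖x - x₀‖) :
    4 * cellAmp t ≤ ε * (‖(Real.pi / 2) • EuclideanSpace.single (1 : Fin 3) (1 : ℝ) +
        (Real.pi / 2) • EuclideanSpace.single (2 : Fin 3) (1 : ℝ) - x₀‖ +
      ‖(-(Real.pi / 2)) • EuclideanSpace.single (1 : Fin 3) (1 : ℝ) +
        (Real.pi / 2) • EuclideanSpace.single (2 : Fin 3) (1 : ℝ) - x₀‖) := by
  -- the segment σ ↦ p σ = (0, σ, π/2)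
  set p : ℝ → EuclideanSpace ℝ (Fin 3) := fun σ => σ • EuclideanSpace.single (1 : Fin 3) (1 : ℝ) +
    (Real.pi / 2) • EuclideanSpace.single (2 : Fin 3) (1 : ℝ) with hp
  have hp1 : ∀ σ, p σ 1 = σ := by intro σ; simp [hp]
  have hp2 : ∀ σ, p σ 2 = Real.pi / 2 := by intro σ; simp [hp]
  -- derivative of ψ ∘ p
  have hderiv : ∀ σ : ℝ, HasDerivAt (ψ ∘ p) (cellAmp t * (2 * Real.cos σ)) σ := by
    intro σ
    have hpσ : HasDerivAt p (EuclideanSpace.single (1 : Fin 3) (1 : ℝ)) σ := by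
      have := ((hasDerivAt_id σ).smul_const (EuclideanSpace.single (1 : Fin 3) (1 : ℝ))).add_const
        ((Real.pi / 2) • EuclideanSpace.single (2 : Fin 3) (1 : ℝ))
      simpa [hp] using this
    have hcomp := (hψ (p σ)).hasFDerivAt.comp_hasDerivAt σ hpσ
    have hval : fderiv ℝ ψ (p σ) (EuclideanSpace.single (1 : Fin 3) (1 : ℝ)) = cellAmp t * (2 * Real.cos σ) := by
      rw [← hcurl (p σ), curl_cellProfile_apply_zero, hp1, hp2, Real.sin_pi_div_two]
      ring
    rwa [hval] at hcomp
  -- fundamental theorem of calculus along the segment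
  have hftc : ∫ σ in (-(Real.pi / 2))..(Real.pi / 2), cellAmp t * (2 * Real.cos σ) =
      (ψ ∘ p) (Real.pi / 2) - (ψ ∘ p) (-(Real.pi / 2)) :=
    intervalIntegral.integral_eq_sub_of_hasDerivAt (fun σ _ => hderiv σ)
      ((continuous_const.mul (continuous_const.mul Real.continuous_cos)).intervalIntegrable _ _)
  simp only [Function.comp] at hftc
  have hint : ∫ σ in (-(Real.pi / 2))..(Real.pi / 2), cellAmp t * (2 * Real.cos σ) = 4 * cellAmp t := by
    rw [intervalIntegral.integral_const_mul, intervalIntegral.integral_const_mul, integral_cos, Real.sin_neg,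
      Real.sin_pi_div_two]
    ring
  have hdiff : ψ (p (Real.pi / 2)) - ψ (p (-(Real.pi / 2))) = 4 * cellAmp t := by rw [← hftc, hint]
  -- the two cone bounds at x₀
  have hplus := hslope (p (Real.pi / 2))
  have hminus := hslope (p (-(Real.pi / 2)))
  have hpp : p (Real.pi / 2) = (Real.pi / 2) • EuclideanSpace.single (1 : Fin 3) (1 : ℝ) +
      (Real.pi / 2) • EuclideanSpace.single (2 : Fin 3) (1 : ℝ) := rfl
  have hpm : p (-(Real.pi / 2)) = (-(Real.pi / 2)) • EuclideanSpace.single (1 : Fin 3) (1 : ℝ) +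
      (Real.pi / 2) • EuclideanSpace.single (2 : Fin 3) (1 : ℝ) := rfl
  rw [← hpp, ← hpm, mul_add]
  have htri : |ψ (p (Real.pi / 2)) - ψ (p (-(Real.pi / 2)))| ≤
      |ψ (p (Real.pi / 2)) - ψ x₀| + |ψ (p (-(Real.pi / 2))) - ψ x₀| := by
    rw [abs_sub_comm (ψ (p (-(Real.pi / 2)))) (ψ x₀)]
    exact abs_sub_le _ _ _
  rw [hdiff, abs_of_nonneg (mul_nonneg (by norm_num) (cellAmp_nonneg t) : (0 : ℝ) ≤ 4 * cellAmp t)] at htri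
  linarith

/-- **The source-gauge stratum contains no separated profile (slope floor ⇒ no decaying slope).** If `ψ(t,·)` is a
differentiable stream function of the cellular profile on every slice (`∂₁ψ(t,·) = (curl v(t))₀` suffices) with the
cone bound `|ψ(t,x) − ψ(t,x₀)| ≤ ε(t)‖x − x₀‖`, then `ε(t)√(−t) ≥ 4/D(x₀) > 0` for all `t < 0`, so
`ε(t)√(−t) ↛ 0` as `t → −∞`: the no-source-gauge hypothesis of S2′ holds VACUOUSLY for the separated cellular profile.
[folklore] -/
theorem no_decayingSlope_streamFunction_cellProfile (ψ : ℝ → EuclideanSpace ℝ (Fin 3) → ℝ)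
    (x₀ : EuclideanSpace ℝ (Fin 3)) (ε : ℝ → ℝ) (hψ : ∀ t < 0, Differentiable ℝ (ψ t))
    (hcurl : ∀ t < 0, ∀ y, curl (cellProfile t) y 0 = fderiv ℝ (ψ t) y (EuclideanSpace.single (1 : Fin 3) (1 : ℝ)))
    (hslope : ∀ t < 0, ∀ x, |ψ t x - ψ t x₀| ≤ ε t * ‖x - x₀‖) :
    ¬ Tendsto (fun t => ε t * Real.sqrt (-t)) atBot (nhds 0) := by
  intro hlim
  set yp : EuclideanSpace ℝ (Fin 3) := (Real.pi / 2) • EuclideanSpace.single (1 : Fin 3) (1 : ℝ) +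
    (Real.pi / 2) • EuclideanSpace.single (2 : Fin 3) (1 : ℝ) with hyp
  set ym : EuclideanSpace ℝ (Fin 3) := (-(Real.pi / 2)) • EuclideanSpace.single (1 : Fin 3) (1 : ℝ) +
    (Real.pi / 2) • EuclideanSpace.single (2 : Fin 3) (1 : ℝ) with hym
  set D : ℝ := ‖yp - x₀‖ + ‖ym - x₀‖ with hD
  have hne : yp ≠ ym := by
    intro h
    have := congrArg (fun w : EuclideanSpace ℝ (Fin 3) => w 1) h
    simp [hyp, hym] at this
    linarith [Real.pi_pos]
  have hDpos : 0 < D := by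
    have h1 : ‖yp - ym‖ ≤ D := by
      calc ‖yp - ym‖ = ‖(yp - x₀) - (ym - x₀)‖ := by congr 1; abel
        _ ≤ ‖yp - x₀‖ + ‖ym - x₀‖ := norm_sub_le _ _
    have h2 : 0 < ‖yp - ym‖ := norm_pos_iff.2 (sub_ne_zero.2 hne)
    linarith
  have hev := (hlim.eventually (gt_mem_nhds (show (0 : ℝ) < 4 / D by positivity))).and
    (eventually_lt_atBot (0 : ℝ))
  obtain ⟨t, ht1, ht2⟩ := hev.exists
  have hfloor := streamFunction_slope_floor_cellProfile t (ψ t) (hψ t ht2) (hcurl t ht2) x₀ (ε t) (hslope t ht2)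
  rw [← hyp, ← hym, ← hD] at hfloor
  have hsq : 0 < Real.sqrt (-t) := Real.sqrt_pos.2 (by linarith)
  have hcs : cellAmp t * Real.sqrt (-t) = 1 := inv_mul_cancel₀ hsq.ne'
  have h4 : 4 ≤ ε t * Real.sqrt (-t) * D := by
    have := mul_le_mul_of_nonneg_right hfloor hsq.le
    nlinarith
  have h5 : ε t * Real.sqrt (-t) * D < 4 := by
    have := (lt_div_iff₀ hDpos).1 ht1
    linarith
  linarith

/-! ## The negative lemma for the rev-7 residue -/

/-- Differentiability of the slices of a `C²` function on the open backward slab. [folklore] -/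
theorem differentiable_slice_of_contDiffOn_slab {ψ : ℝ → EuclideanSpace ℝ (Fin 3) → ℝ}
    (hψ : ContDiffOn ℝ 2 (Function.uncurry ψ) (Set.Iio (0 : ℝ) ×ˢ Set.univ)) {t : ℝ} (ht : t < 0) :
    Differentiable ℝ (ψ t) := by
  intro x
  have hmem : (t, x) ∈ Set.Iio (0 : ℝ) ×ˢ (Set.univ : Set (EuclideanSpace ℝ (Fin 3))) := ⟨ht, trivial⟩
  have hopen : IsOpen (Set.Iio (0 : ℝ) ×ˢ (Set.univ : Set (EuclideanSpace ℝ (Fin 3)))) :=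
    isOpen_Iio.prod isOpen_univ
  have h1 : DifferentiableAt ℝ (Function.uncurry ψ) (t, x) :=
    (hψ.differentiableOn (by norm_num)).differentiableAt (hopen.mem_nhds hmem)
  have h2 : DifferentiableAt ℝ (fun y : EuclideanSpace ℝ (Fin 3) => (t, y)) x :=
    (differentiableAt_const t).prodMk differentiableAt_id
  exact h1.comp x h2

/-- **The rev-7 residue `stub_residueNoScrewNoGauge` of K2 without the Oseen-mild identity (and without the all-frames
axisymmetry exclusion) is FALSE.** The statement below is VERBATIM the registered signature of S2′ (skeleton
`Cruxes/PoloidalWindowRigidity/Lines/slicesharp.lean`, rev 7) with its third hypothesis (the Oseen-mild identity (M))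
and its eleventh (no axisymmetry in any frame) deleted; the separated cellular profile `(−t)^{-1/2} V(x)` refutes it —
the no-screw clause by `not_screwInvariant_cellProfile`, the no-source-gauge clause VACUOUSLY by the slope floor
(`no_decayingSlope_streamFunction_cellProfile`). So on the separated stratum (M) is the load-bearing hypothesis of S2′,
and the two strata excluded at rev 7 do not meet it. [folklore] -/
theorem residueNoScrewNoGauge_false_without_mild :
    ¬ (∀ (C : ℝ) (v : ℝ → EuclideanSpace ℝ (Fin 3) → EuclideanSpace ℝ (Fin 3)),
      Literature.Analysis.FluidPDE.HasTypeITimeDecay C v →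
      ContinuousOn (Function.uncurry v) (Set.Iio (0 : ℝ) ×ˢ Set.univ) →
      (∀ t < 0, Literature.Analysis.FluidPDE.VectorCalculus.IsDivFree (v t)) →
      (∀ s < 0, ∀ y, ⟪Literature.Analysis.FluidPDE.curl (v s) y, EuclideanSpace.single 2 1⟫_ℝ = 0) →
      (∀ s < 0, ∀ y, ⟪fderiv ℝ (v s) y (Literature.Analysis.FluidPDE.curl (v s) y), EuclideanSpace.single 2 1⟫_ℝ = 0) →
      (∀ s < 0, ∀ b : EuclideanSpace ℝ (Fin 3), b ≠ 0 → ∃ y,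
        Literature.Analysis.FluidPDE.cross (Literature.Analysis.FluidPDE.curl (v s) y) b ≠ 0) →
      (∀ s < 0, ∃ y, fderiv ℝ (v s) y (EuclideanSpace.single 2 1) 0 ≠ 0 ∨
        fderiv ℝ (v s) y (EuclideanSpace.single 2 1) 1 ≠ 0) →
      (∀ s < 0, ∀ a : EuclideanSpace ℝ (Fin 3), a ≠ 0 → ⟪a, EuclideanSpace.single 2 1⟫_ℝ = 0 →
        ∃ y, ⟪fderiv ℝ (v s) y a, EuclideanSpace.single 2 1⟫_ℝ ≠ 0) →
      (∀ s < 0, ∀ e : EuclideanSpace ℝ (Fin 3), e ≠ 0 → ∃ (y : EuclideanSpace ℝ (Fin 3)) (l : ℝ), v s (y + l • e) ≠ v s y) →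
      (∃ lam : ℝ, 0 < lam ∧ ∃ s < 0, ∃ y, lam • v (lam ^ 2 * s) (lam • y) ≠ v s y) →
      (∀ κ : ℝ, κ ≠ 0 → ∀ c : EuclideanSpace ℝ (Fin 3), ∃ s < 0, ∃ (a : ℝ) (y : EuclideanSpace ℝ (Fin 3)),
        v s (c + Literature.Analysis.FluidPDE.rotZ (κ * a) (y - c) + a • EuclideanSpace.single 2 (1 : ℝ)) ≠
          Literature.Analysis.FluidPDE.rotZ (κ * a) (v s y)) →
      (∀ (ψ : ℝ → EuclideanSpace ℝ (Fin 3) → ℝ) (src : ℝ → ℝ) (x₀ : EuclideanSpace ℝ (Fin 3)) (ε : ℝ → ℝ),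
        ContDiffOn ℝ 2 (Function.uncurry ψ) (Set.Iio (0 : ℝ) ×ˢ Set.univ) →
        (∀ t < 0, ∀ y, Literature.Analysis.FluidPDE.curl (v t) y 0 = fderiv ℝ (ψ t) y (EuclideanSpace.single 1 1) ∧
          Literature.Analysis.FluidPDE.curl (v t) y 1 = -fderiv ℝ (ψ t) y (EuclideanSpace.single 0 1)) →
        (∀ t < 0, ∀ x, |ψ t x - ψ t x₀| ≤ ε t * ‖x - x₀‖) →
        ContinuousOn ε (Set.Iio 0) →
        Filter.Tendsto (fun t => ε t * Real.sqrt (-t)) Filter.atBot (nhds 0) →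
        ∃ t < 0, ∃ x, deriv (fun τ => ψ τ x) t + fderiv ℝ (ψ t) x (v t x) - (Δ (ψ t)) x ≠ src t) →
      ¬ Literature.Analysis.FluidPDE.IsBackwardSingularPoint v 0) := by
  intro h
  refine h 4 cellProfile hasTypeITimeDecay_cellProfile continuousOn_cellProfile (fun t _ => isDivFree_cellProfile t)
    (fun s _ y => poloidal_cellProfile s y) (fun s _ y => frozen_cellProfile s y)
    (fun s hs b hb => vorticityDirection_nonconstant_cellProfile hs b hb)
    (fun s hs => ⟨_, Or.inl (not_vertRigid_cellProfile hs)⟩)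
    (fun s hs a ha ha2 => flat_in_no_horizontal_direction_cellProfile hs a ha ha2)
    (fun s hs e he => not_translationInvariant_cellProfile hs e he)
    ⟨2, two_pos, -1, by norm_num, _, not_scaleInvariant_cellProfile⟩
    (fun κ _ c => ⟨-1, by norm_num, Real.pi / 2, not_screwInvariant_cellProfile (κ * (Real.pi / 2)) c⟩)
    ?_ isBackwardSingularPoint_cellProfile
  intro ψ src x₀ ε hψ hcurl hslope _ hεt
  exact absurd hεt (no_decayingSlope_streamFunction_cellProfile ψ x₀ ε
    (fun t ht => differentiable_slice_of_contDiffOn_slab hψ ht) (fun t ht y => (hcurl t ht y).1) hslope)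

end Summit.NavierStokesRegularity.NavierStokesRegularity.Theorems.PoloidalWindowRigidity.Negative

end
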